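import Mathlib
import Summits.NavierStokesRegularity.FluidComputer.AbcFlowSphTailForms
import Summits.NavierStokesRegularity.FluidComputer.AbcKappa0TailLevels
import HarnessLib

/-!
# The tail boxes of the cap2 ladder certificates (R 300, R 500; spherical shells, booking norm `g_κ₀`) as theorems about `Torus.abcFlow 1 1 1` (cap2 g2, cell `ns-blowup`, 2026-08-26)

HONEST FRAMING (human ruling D-0035): nothing here is a claim about Navier–Stokes blow-up.
WHAT THIS IS NOT: not NS evidence. MODEL/linear (forced `abc(1,1,1)` linearisation, `f = νU`). The
three THEOREM 3-L certificates of record of the cap2 ladder (`HOME/cap2/LADDER-CENSUS.md` §A;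
engine `d2s_cert.py` 526db1ca2d823856) are
R 300 class I (`M_G ≤ 8.13132`; STATUS l.2586, kit j250039), R 300 class II (`14.7697`; l.2844,
j251558), R 500 class II (`14.6298`; l.3947, j250881): spherical shells, section `s ≤ K` with
`K = 39` (R 300) / `K = 51` (R 500), analytic tail `|k| ≥ K + 1 = 40` / `52`, rate `ω = 2/5` / `11/25`,
booking norm `g_κ₀ = ‖(κ₀² − Δ)·‖` with `κ₀ = 17` / `22`, tail weight `τ`. Their TAIL step (S7 of
`cap/D2-CHAIN-MAP.md`) uses the single constant `η_t = min(η₂, η₁, η₀)` of `cap/D2-TAIL-KAPPA0.md`,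
printed by the jobs as `eta_t >= 0.706095` (R 300) and `0.855321` (R 500), binding level `η₂`.
This file makes that step kernel for the tree's ABC object, as `AbcFlowCubeTailAt25` (p437718) did
for cap's cube cell at R 100:

* `abc_sph_weighted_tail_form_le` — the `g_κ₀` TAIL SENTENCE in general: for every `K`, `ν ≥ 0`,
  `ω`, `κ₀² ≥ 0` and every smooth `w` with `𝓕w(k) = 0` on `|k|² < (K+1)²`, the weighted form
  `q₂ + 2κ₀²q₁ + κ₀⁴q₀` of the three level forms of `AbcFlowSphTailForms` (normalised to the unit
  torus: `q₂ = (1/16π⁴)·[H² form]`, `q₁ = (1/4π²)·[H¹ form]`, `q₀ = [L² form]`) is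
  `≤ −min(η₂, min(η₁', η₀))·(‖Δw‖²/16π⁴ + 2κ₀²‖∇w‖²/4π² + κ₀⁴‖w‖²)` — `weighted_levels_le` (p416347)
  composed with the three spherical levels; the right-hand factor is `‖(κ₀² − Δ/4π²)w‖²`, the
  `y`-energy of the tail block (`AbcKappa0TailLevels.weight_sq_expand`, mode by mode);
* threshold arithmetic: `eta2_at_40_bounds` (`0.70609 < η₂ < 0.70610` at `(ν, ω, K+1) = (1/300, 2/5, 40)`),
  `eta1_at_40_gt` (`2.5437 < η₁'`), `eta0_at_40_gt` (`4.3191 < η₀`), `eta_t_at_40_eq_eta2`, `eta_t_at_40_pos`;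
  `eta2_at_52_bounds` (`0.85532 < η₂ < 0.85533` at `(1/500, 11/25, 52)`), `eta1_at_52_gt` (`2.6684`),
  `eta0_at_52_gt` (`4.4337`), `eta_t_at_52_eq_eta2`, `eta_t_at_52_pos`;
* the boxes as numbers: `abc_sph_h2_tail_at_40` (`H²` form `≤ −0.70609·‖Δw‖²`), `abc_sph_weighted_tail_at_40`
  (the `g_κ₀` tail sentence `≤ −0.70609·‖y‖²` for every `κ₀² ≥ 0`, in particular `κ₀ = 17`), and
  `abc_sph_h2_tail_at_52` / `abc_sph_weighted_tail_at_52` (`≤ −0.85532·…`; `κ₀ = 22`).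

Print nit recorded for the census keeper: `η₂(40) = 0.7060958…`, so the lower bound reads `≥ 0.70609`
(as the VERDICT line of j250039 prints), not the `0.70610` of LADDER-CENSUS §A rows R 300.
(`η₁` appears here with the generic kernel constant `√3/(K+1)` (`AbcFlowSphTailForms`), the script
prints the memo's `1/(K+1)`; both sit far above the binding `η₂`, cf. `AbcKappa0TailLevels` appendix.)

Mathlib + `AbcFlowSphTailForms` + `AbcKappa0TailLevels`; no new definitions.
-/

noncomputable section

namespace Summit.NavierStokesRegularity.FluidComputer.AbcFlowSphTailLadder

open Literature.Analysis.FluidPDE Literature.Analysis.FunctionSpaces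
open Literature.Analysis.FunctionSpaces.Torus MeasureTheory UnitAddTorus
open Summit.NavierStokesRegularity.FluidComputer.AbcFlowSphTailForms
open Summit.NavierStokesRegularity.FluidComputer.AbcKappa0TailLevels
open scoped RealInnerProductSpace

/-! ## The `g_κ₀` tail sentence for a general spherical cell -/

/-- **TAIL hypothesis of THEOREM 3-L in the booking norm `g_κ₀`, spherical tail `|k| ≥ K + 1`.**
For `U = abc(1,1,1)` on the unit torus, `ν ≥ 0`, `ω ∈ ℝ`, `κsq = κ₀² ≥ 0`, and every smooth `w`
whose Fourier coefficients vanish on `|k|² < (K+1)²`: with the three level forms of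
`AbcFlowSphTailForms` normalised to the unit torus,
`q₂ + 2κ₀²·q₁ + κ₀⁴·q₀ ≤ −min(η₂, min(η₁', η₀))·(‖Δw‖₂²/16π⁴ + 2κ₀²·‖∇w‖₂²/4π² + κ₀⁴‖w‖₂²)`,
`η₂ = ν(K+1)² + ω − (2√3+√2) − (√6+2√3)/(K+1) − √3/(K+1)²`, `η₁' = ν(K+1)² + ω − (√3+√2) − √3/(K+1)`,
`η₀ = ν(K+1)² + ω − √2`. -/
theorem abc_sph_weighted_tail_form_le {w : UnitAddTorus (Fin 3) → EuclideanSpace ℝ (Fin 3)}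
    (hw : IsSmooth w) {K : ℕ}
    (hsph : ∀ k : Fin 3 → ℤ, freqNormSq k < ((K : ℝ) + 1) ^ 2 →
      mFourierCoeff (EuclideanSpace.complexify ∘ w) k = 0)
    {ν ω κsq : ℝ} (hν : 0 ≤ ν) (hκ : 0 ≤ κsq) :
    1 / (16 * Real.pi ^ 4) *
        (ν / (4 * Real.pi ^ 2) * (∫ y, ⟪laplacian (laplacian w) y, laplacian w y⟫)
          - 1 / (2 * Real.pi) * (∫ y, ⟪convect (Torus.abcFlow 1 1 1) w y + convect w (Torus.abcFlow 1 1 1) y,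
              laplacian (laplacian w) y⟫)
          - ω * (∫ y, ‖laplacian w y‖ ^ 2))
      + 2 * κsq * (1 / (4 * Real.pi ^ 2) *
        (-(ν / (4 * Real.pi ^ 2) * ∫ y, ‖laplacian w y‖ ^ 2)
          + 1 / (2 * Real.pi) * (∫ y, ⟪convect (Torus.abcFlow 1 1 1) w y + convect w (Torus.abcFlow 1 1 1) y,
              laplacian w y⟫)
          - ω * gradNormSq w))
      + κsq ^ 2 *
        (ν / (4 * Real.pi ^ 2) * (∫ y, ⟪laplacian w y, w y⟫)
          - 1 / (2 * Real.pi) * (∫ y, ⟪convect (Torus.abcFlow 1 1 1) w y + convect w (Torus.abcFlow 1 1 1) y, w y⟫)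
          - ω * (∫ y, ‖w y‖ ^ 2))
      ≤ -(min (ν * ((K : ℝ) + 1) ^ 2 + ω - (2 * Real.sqrt 3 + Real.sqrt 2)
              - (Real.sqrt 6 + 2 * Real.sqrt 3) / ((K : ℝ) + 1) - Real.sqrt 3 / ((K : ℝ) + 1) ^ 2)
            (min (ν * ((K : ℝ) + 1) ^ 2 + ω - (Real.sqrt 3 + Real.sqrt 2) - Real.sqrt 3 / ((K : ℝ) + 1))
              (ν * ((K : ℝ) + 1) ^ 2 + ω - Real.sqrt 2))) *
        (1 / (16 * Real.pi ^ 4) * (∫ y, ‖laplacian w y‖ ^ 2)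
          + 2 * κsq * (1 / (4 * Real.pi ^ 2) * gradNormSq w)
          + κsq ^ 2 * (∫ y, ‖w y‖ ^ 2)) := by
  have hπ : 0 < Real.pi := Real.pi_pos
  have c2 : 0 < 1 / (16 * Real.pi ^ 4) := by positivity
  have c1 : 0 < 1 / (4 * Real.pi ^ 2) := by positivity
  have hY : 0 ≤ ∫ y, ‖laplacian w y‖ ^ 2 := integral_nonneg fun y => sq_nonneg _
  have hG : 0 ≤ gradNormSq w := gradNormSq_nonneg _
  have hE : 0 ≤ ∫ y, ‖w y‖ ^ 2 := integral_nonneg fun y => sq_nonneg _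
  have h2 := abc_sph_h2_tail_form_le hw hsph (ν := ν) (ω := ω) hν
  have h1 := abc_sph_h1_tail_form_le hw hsph (ν := ν) (ω := ω) hν
  have h0 := abc_sph_l2_tail_form_le hw hsph (ν := ν) hν ω
  set η₂ : ℝ := ν * ((K : ℝ) + 1) ^ 2 + ω - (2 * Real.sqrt 3 + Real.sqrt 2)
      - (Real.sqrt 6 + 2 * Real.sqrt 3) / ((K : ℝ) + 1) - Real.sqrt 3 / ((K : ℝ) + 1) ^ 2 with hη₂
  set η₁ : ℝ := ν * ((K : ℝ) + 1) ^ 2 + ω - (Real.sqrt 3 + Real.sqrt 2) - Real.sqrt 3 / ((K : ℝ) + 1) with hη₁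
  set η₀ : ℝ := ν * ((K : ℝ) + 1) ^ 2 + ω - Real.sqrt 2 with hη₀
  set Y : ℝ := ∫ y, ‖laplacian w y‖ ^ 2 with hYdef
  set G : ℝ := gradNormSq w with hGdef
  set E : ℝ := ∫ y, ‖w y‖ ^ 2 with hEdef
  set F2 : ℝ := ν / (4 * Real.pi ^ 2) * (∫ y, ⟪laplacian (laplacian w) y, laplacian w y⟫)
      - 1 / (2 * Real.pi) * (∫ y, ⟪convect (Torus.abcFlow 1 1 1) w y + convect w (Torus.abcFlow 1 1 1) y,
          laplacian (laplacian w) y⟫)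
      - ω * Y with hF2
  set F1 : ℝ := -(ν / (4 * Real.pi ^ 2) * Y)
      + 1 / (2 * Real.pi) * (∫ y, ⟪convect (Torus.abcFlow 1 1 1) w y + convect w (Torus.abcFlow 1 1 1) y,
          laplacian w y⟫)
      - ω * G with hF1
  set F0 : ℝ := ν / (4 * Real.pi ^ 2) * (∫ y, ⟪laplacian w y, w y⟫)
      - 1 / (2 * Real.pi) * (∫ y, ⟪convect (Torus.abcFlow 1 1 1) w y + convect w (Torus.abcFlow 1 1 1) y, w y⟫)
      - ω * E with hF0
  have g2 : F2 ≤ -η₂ * Y := by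
    refine h2.trans (le_of_eq ?_)
    rw [hη₂]; ring
  have g1 : F1 ≤ -η₁ * G := by
    refine h1.trans (le_of_eq ?_)
    rw [hη₁]; ring
  have g0 : F0 ≤ -η₀ * E := by
    refine h0.trans (le_of_eq ?_)
    rw [hη₀]; ring
  have g2' : 1 / (16 * Real.pi ^ 4) * F2 ≤ -η₂ * (1 / (16 * Real.pi ^ 4) * Y) := by
    have := mul_le_mul_of_nonneg_left g2 c2.le
    linarith
  have g1' : 1 / (4 * Real.pi ^ 2) * F1 ≤ -η₁ * (1 / (4 * Real.pi ^ 2) * G) := by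
    have := mul_le_mul_of_nonneg_left g1 c1.le
    linarith
  exact weighted_levels_le (1 / (16 * Real.pi ^ 4) * F2) (1 / (4 * Real.pi ^ 2) * F1) F0
    (1 / (16 * Real.pi ^ 4) * Y) (1 / (4 * Real.pi ^ 2) * G) E κsq η₂ η₁ η₀
    (mul_nonneg c2.le hY) (mul_nonneg c1.le hG) hE hκ g2' g1' g0

/-! ## Threshold arithmetic -/

/-- `1.41421356 < √2 < 1.41421357`. -/
private theorem sqrt2_bounds : (1.41421356 : ℝ) < Real.sqrt 2 ∧ Real.sqrt 2 < 1.41421357 := by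
  constructor
  · rw [show (1.41421356 : ℝ) = Real.sqrt (1.41421356 ^ 2) by rw [Real.sqrt_sq (by norm_num)]]
    exact Real.sqrt_lt_sqrt (by norm_num) (by norm_num)
  · rw [show (1.41421357 : ℝ) = Real.sqrt (1.41421357 ^ 2) by rw [Real.sqrt_sq (by norm_num)]]
    exact Real.sqrt_lt_sqrt (by norm_num) (by norm_num)

/-- `1.73205080 < √3 < 1.73205081`. -/
private theorem sqrt3_bounds : (1.73205080 : ℝ) < Real.sqrt 3 ∧ Real.sqrt 3 < 1.73205081 := by
  constructor
  · rw [show (1.73205080 : ℝ) = Real.sqrt (1.73205080 ^ 2) by rw [Real.sqrt_sq (by norm_num)]]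
    exact Real.sqrt_lt_sqrt (by norm_num) (by norm_num)
  · rw [show (1.73205081 : ℝ) = Real.sqrt (1.73205081 ^ 2) by rw [Real.sqrt_sq (by norm_num)]]
    exact Real.sqrt_lt_sqrt (by norm_num) (by norm_num)

/-- `2.44948974 < √6 < 2.44948975`. -/
private theorem sqrt6_bounds : (2.44948974 : ℝ) < Real.sqrt 6 ∧ Real.sqrt 6 < 2.44948975 := by
  constructor
  · rw [show (2.44948974 : ℝ) = Real.sqrt (2.44948974 ^ 2) by rw [Real.sqrt_sq (by norm_num)]]
    exact Real.sqrt_lt_sqrt (by norm_num) (by norm_num)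
  · rw [show (2.44948975 : ℝ) = Real.sqrt (2.44948975 ^ 2) by rw [Real.sqrt_sq (by norm_num)]]
    exact Real.sqrt_lt_sqrt (by norm_num) (by norm_num)

/-- **R 300 cells (`K + 1 = 40`, `ν = 1/300`, `ω = 2/5`): `0.70609 < η₂ < 0.70610`**
(`η₂ = 0.7060958…`; jobs j250039 / j251558 print `eta^(2) >= 0.706095`). -/
theorem eta2_at_40_bounds :
    (0.70609 : ℝ) < (1 / 300 : ℝ) * 40 ^ 2 + 2 / 5 - (2 * Real.sqrt 3 + Real.sqrt 2)
        - (Real.sqrt 6 + 2 * Real.sqrt 3) / 40 - Real.sqrt 3 / 40 ^ 2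
    ∧ (1 / 300 : ℝ) * 40 ^ 2 + 2 / 5 - (2 * Real.sqrt 3 + Real.sqrt 2)
        - (Real.sqrt 6 + 2 * Real.sqrt 3) / 40 - Real.sqrt 3 / 40 ^ 2 < (0.70610 : ℝ) := by
  obtain ⟨a2, b2⟩ := sqrt2_bounds
  obtain ⟨a3, b3⟩ := sqrt3_bounds
  obtain ⟨a6, b6⟩ := sqrt6_bounds
  constructor <;> nlinarith

/-- R 300: `2.5437 < η₁'` (`η₁' = ν·40² + ω − (√3+√2) − √3/40 = 2.54376…`). -/
theorem eta1_at_40_gt :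
    (2.5437 : ℝ) < (1 / 300 : ℝ) * 40 ^ 2 + 2 / 5 - (Real.sqrt 3 + Real.sqrt 2) - Real.sqrt 3 / 40 := by
  obtain ⟨a2, b2⟩ := sqrt2_bounds
  obtain ⟨a3, b3⟩ := sqrt3_bounds
  nlinarith

/-- R 300: `4.3191 < η₀` (`η₀ = ν·40² + ω − √2 = 4.31911…`). -/
theorem eta0_at_40_gt :
    (4.3191 : ℝ) < (1 / 300 : ℝ) * 40 ^ 2 + 2 / 5 - Real.sqrt 2 := by
  obtain ⟨a2, b2⟩ := sqrt2_bounds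
  nlinarith

/-- R 300: the binding tail level is `η₂` (`min(η₂, min(η₁', η₀)) = η₂`). -/
theorem eta_t_at_40_eq_eta2 :
    min ((1 / 300 : ℝ) * 40 ^ 2 + 2 / 5 - (2 * Real.sqrt 3 + Real.sqrt 2)
          - (Real.sqrt 6 + 2 * Real.sqrt 3) / 40 - Real.sqrt 3 / 40 ^ 2)
      (min ((1 / 300 : ℝ) * 40 ^ 2 + 2 / 5 - (Real.sqrt 3 + Real.sqrt 2) - Real.sqrt 3 / 40)
        ((1 / 300 : ℝ) * 40 ^ 2 + 2 / 5 - Real.sqrt 2))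
    = (1 / 300 : ℝ) * 40 ^ 2 + 2 / 5 - (2 * Real.sqrt 3 + Real.sqrt 2)
          - (Real.sqrt 6 + 2 * Real.sqrt 3) / 40 - Real.sqrt 3 / 40 ^ 2 := by
  have h2 := eta2_at_40_bounds.2
  have h1 := eta1_at_40_gt
  have h0 := eta0_at_40_gt
  refine min_eq_left (le_min ?_ ?_) <;> linarith

/-- R 300: `η_t = min(η₂, min(η₁', η₀)) > 0` (indeed `> 0.70609`). -/
theorem eta_t_at_40_pos :
    0 < min ((1 / 300 : ℝ) * 40 ^ 2 + 2 / 5 - (2 * Real.sqrt 3 + Real.sqrt 2)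
          - (Real.sqrt 6 + 2 * Real.sqrt 3) / 40 - Real.sqrt 3 / 40 ^ 2)
      (min ((1 / 300 : ℝ) * 40 ^ 2 + 2 / 5 - (Real.sqrt 3 + Real.sqrt 2) - Real.sqrt 3 / 40)
        ((1 / 300 : ℝ) * 40 ^ 2 + 2 / 5 - Real.sqrt 2)) := by
  rw [eta_t_at_40_eq_eta2]
  linarith [eta2_at_40_bounds.1]

/-- **R 500 cell (`K + 1 = 52`, `ν = 1/500`, `ω = 11/25`): `0.85532 < η₂ < 0.85533`**
(`η₂ = 0.8553213…`; job j250881 prints `eta_t >= 0.855321`). -/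
theorem eta2_at_52_bounds :
    (0.85532 : ℝ) < (1 / 500 : ℝ) * 52 ^ 2 + 11 / 25 - (2 * Real.sqrt 3 + Real.sqrt 2)
        - (Real.sqrt 6 + 2 * Real.sqrt 3) / 52 - Real.sqrt 3 / 52 ^ 2
    ∧ (1 / 500 : ℝ) * 52 ^ 2 + 11 / 25 - (2 * Real.sqrt 3 + Real.sqrt 2)
        - (Real.sqrt 6 + 2 * Real.sqrt 3) / 52 - Real.sqrt 3 / 52 ^ 2 < (0.85533 : ℝ) := by
  obtain ⟨a2, b2⟩ := sqrt2_bounds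
  obtain ⟨a3, b3⟩ := sqrt3_bounds
  obtain ⟨a6, b6⟩ := sqrt6_bounds
  constructor <;> nlinarith

/-- R 500: `2.6684 < η₁'` (`η₁' = 2.66842…`). -/
theorem eta1_at_52_gt :
    (2.6684 : ℝ) < (1 / 500 : ℝ) * 52 ^ 2 + 11 / 25 - (Real.sqrt 3 + Real.sqrt 2) - Real.sqrt 3 / 52 := by
  obtain ⟨a2, b2⟩ := sqrt2_bounds
  obtain ⟨a3, b3⟩ := sqrt3_bounds
  nlinarith

/-- R 500: `4.4337 < η₀` (`η₀ = 4.43378…`). -/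
theorem eta0_at_52_gt :
    (4.4337 : ℝ) < (1 / 500 : ℝ) * 52 ^ 2 + 11 / 25 - Real.sqrt 2 := by
  obtain ⟨a2, b2⟩ := sqrt2_bounds
  nlinarith

/-- R 500: the binding tail level is `η₂`. -/
theorem eta_t_at_52_eq_eta2 :
    min ((1 / 500 : ℝ) * 52 ^ 2 + 11 / 25 - (2 * Real.sqrt 3 + Real.sqrt 2)
          - (Real.sqrt 6 + 2 * Real.sqrt 3) / 52 - Real.sqrt 3 / 52 ^ 2)
      (min ((1 / 500 : ℝ) * 52 ^ 2 + 11 / 25 - (Real.sqrt 3 + Real.sqrt 2) - Real.sqrt 3 / 52)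
        ((1 / 500 : ℝ) * 52 ^ 2 + 11 / 25 - Real.sqrt 2))
    = (1 / 500 : ℝ) * 52 ^ 2 + 11 / 25 - (2 * Real.sqrt 3 + Real.sqrt 2)
          - (Real.sqrt 6 + 2 * Real.sqrt 3) / 52 - Real.sqrt 3 / 52 ^ 2 := by
  have h2 := eta2_at_52_bounds.2
  have h1 := eta1_at_52_gt
  have h0 := eta0_at_52_gt
  refine min_eq_left (le_min ?_ ?_) <;> linarith

/-- R 500: `η_t > 0` (indeed `> 0.85532`). -/
theorem eta_t_at_52_pos :
    0 < min ((1 / 500 : ℝ) * 52 ^ 2 + 11 / 25 - (2 * Real.sqrt 3 + Real.sqrt 2)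
          - (Real.sqrt 6 + 2 * Real.sqrt 3) / 52 - Real.sqrt 3 / 52 ^ 2)
      (min ((1 / 500 : ℝ) * 52 ^ 2 + 11 / 25 - (Real.sqrt 3 + Real.sqrt 2) - Real.sqrt 3 / 52)
        ((1 / 500 : ℝ) * 52 ^ 2 + 11 / 25 - Real.sqrt 2)) := by
  rw [eta_t_at_52_eq_eta2]
  linarith [eta2_at_52_bounds.1]

/-! ## The boxes as numbers -/

/-- **R 300: the `H²` tail level as a number, `η₂ ≥ 0.70609`.** For every smooth `w` whose Fourier
coefficients vanish on `|k|² < 40²`: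
`(ν/4π²)∫⟪ΔΔw,Δw⟫ − (1/2π)∫⟪(U·∇)w + (w·∇)U, ΔΔw⟫ − ω‖Δw‖₂² ≤ −0.70609·‖Δw‖₂²`, `ν = 1/300`, `ω = 2/5`. -/
theorem abc_sph_h2_tail_at_40 {w : UnitAddTorus (Fin 3) → EuclideanSpace ℝ (Fin 3)} (hw : IsSmooth w)
    (hsph : ∀ k : Fin 3 → ℤ, freqNormSq k < (40 : ℝ) ^ 2 →
      mFourierCoeff (EuclideanSpace.complexify ∘ w) k = 0) :
    (1 / 300 : ℝ) / (4 * Real.pi ^ 2) * (∫ y, ⟪laplacian (laplacian w) y, laplacian w y⟫)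
      - 1 / (2 * Real.pi) * (∫ y, ⟪convect (Torus.abcFlow 1 1 1) w y + convect w (Torus.abcFlow 1 1 1) y,
          laplacian (laplacian w) y⟫)
      - (2 / 5 : ℝ) * (∫ y, ‖laplacian w y‖ ^ 2)
      ≤ -(0.70609 : ℝ) * (∫ y, ‖laplacian w y‖ ^ 2) := by
  have hsph' : ∀ k : Fin 3 → ℤ, freqNormSq k < (((39 : ℕ) : ℝ) + 1) ^ 2 →
      mFourierCoeff (EuclideanSpace.complexify ∘ w) k = 0 := fun k hk => hsph k (by norm_num at hk ⊢; exact hk)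
  have h := abc_sph_h2_tail_form_le hw hsph' (ν := 1 / 300) (ω := 2 / 5) (by norm_num)
  have hY : 0 ≤ ∫ y, ‖laplacian w y‖ ^ 2 := integral_nonneg fun y => sq_nonneg _
  have hη := eta2_at_40_bounds.1
  have e : ((39 : ℕ) : ℝ) + 1 = 40 := by norm_num
  rw [e] at h
  refine h.trans (mul_le_mul_of_nonneg_right ?_ hY)
  linarith

/-- **R 300: the `g_κ₀` TAIL SENTENCE as a number.** For every `κsq = κ₀² ≥ 0` (the cells of record
use `κ₀ = 17`) and every smooth `w` with `𝓕w(k) = 0` on `|k|² < 40²`, the weighted tail form is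
`≤ −0.70609·(‖Δw‖²/16π⁴ + 2κ₀²‖∇w‖²/4π² + κ₀⁴‖w‖²)` — the TAIL hypothesis of
`ShellBlockLyapunovCertificate.generator_form_le_of_certificate` with `η_t = 0.70609` in the
`y = (κ₀² − Δ/4π²)w` energy (times the jobs' `τ`), `ν = 1/300`, `ω = 2/5`. -/
theorem abc_sph_weighted_tail_at_40 {w : UnitAddTorus (Fin 3) → EuclideanSpace ℝ (Fin 3)} (hw : IsSmooth w)
    (hsph : ∀ k : Fin 3 → ℤ, freqNormSq k < (40 : ℝ) ^ 2 →
      mFourierCoeff (EuclideanSpace.complexify ∘ w) k = 0)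
    {κsq : ℝ} (hκ : 0 ≤ κsq) :
    1 / (16 * Real.pi ^ 4) *
        ((1 / 300 : ℝ) / (4 * Real.pi ^ 2) * (∫ y, ⟪laplacian (laplacian w) y, laplacian w y⟫)
          - 1 / (2 * Real.pi) * (∫ y, ⟪convect (Torus.abcFlow 1 1 1) w y + convect w (Torus.abcFlow 1 1 1) y,
              laplacian (laplacian w) y⟫)
          - (2 / 5 : ℝ) * (∫ y, ‖laplacian w y‖ ^ 2))
      + 2 * κsq * (1 / (4 * Real.pi ^ 2) *
        (-((1 / 300 : ℝ) / (4 * Real.pi ^ 2) * ∫ y, ‖laplacian w y‖ ^ 2)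
          + 1 / (2 * Real.pi) * (∫ y, ⟪convect (Torus.abcFlow 1 1 1) w y + convect w (Torus.abcFlow 1 1 1) y,
              laplacian w y⟫)
          - (2 / 5 : ℝ) * gradNormSq w))
      + κsq ^ 2 *
        ((1 / 300 : ℝ) / (4 * Real.pi ^ 2) * (∫ y, ⟪laplacian w y, w y⟫)
          - 1 / (2 * Real.pi) * (∫ y, ⟪convect (Torus.abcFlow 1 1 1) w y + convect w (Torus.abcFlow 1 1 1) y, w y⟫)
          - (2 / 5 : ℝ) * (∫ y, ‖w y‖ ^ 2))
      ≤ -(0.70609 : ℝ) *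
        (1 / (16 * Real.pi ^ 4) * (∫ y, ‖laplacian w y‖ ^ 2)
          + 2 * κsq * (1 / (4 * Real.pi ^ 2) * gradNormSq w)
          + κsq ^ 2 * (∫ y, ‖w y‖ ^ 2)) := by
  have hπ : 0 < Real.pi := Real.pi_pos
  have hsph' : ∀ k : Fin 3 → ℤ, freqNormSq k < (((39 : ℕ) : ℝ) + 1) ^ 2 →
      mFourierCoeff (EuclideanSpace.complexify ∘ w) k = 0 := fun k hk => hsph k (by norm_num at hk ⊢; exact hk)
  have h := abc_sph_weighted_tail_form_le hw hsph' (ν := 1 / 300) (ω := 2 / 5) (by norm_num) hκ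
  have e : ((39 : ℕ) : ℝ) + 1 = 40 := by norm_num
  rw [e, eta_t_at_40_eq_eta2] at h
  have hY : 0 ≤ ∫ y, ‖laplacian w y‖ ^ 2 := integral_nonneg fun y => sq_nonneg _
  have hG : 0 ≤ gradNormSq w := gradNormSq_nonneg _
  have hE : 0 ≤ ∫ y, ‖w y‖ ^ 2 := integral_nonneg fun y => sq_nonneg _
  have hpos : 0 ≤ 1 / (16 * Real.pi ^ 4) * (∫ y, ‖laplacian w y‖ ^ 2)
      + 2 * κsq * (1 / (4 * Real.pi ^ 2) * gradNormSq w) + κsq ^ 2 * (∫ y, ‖w y‖ ^ 2) := by positivity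
  have hη := eta2_at_40_bounds.1
  refine h.trans (mul_le_mul_of_nonneg_right ?_ hpos)
  linarith

/-- **R 500: the `H²` tail level as a number, `η₂ ≥ 0.85532`** (`ν = 1/500`, `ω = 11/25`, tail `|k| ≥ 52`). -/
theorem abc_sph_h2_tail_at_52 {w : UnitAddTorus (Fin 3) → EuclideanSpace ℝ (Fin 3)} (hw : IsSmooth w)
    (hsph : ∀ k : Fin 3 → ℤ, freqNormSq k < (52 : ℝ) ^ 2 →
      mFourierCoeff (EuclideanSpace.complexify ∘ w) k = 0) :
    (1 / 500 : ℝ) / (4 * Real.pi ^ 2) * (∫ y, ⟪laplacian (laplacian w) y, laplacian w y⟫)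
      - 1 / (2 * Real.pi) * (∫ y, ⟪convect (Torus.abcFlow 1 1 1) w y + convect w (Torus.abcFlow 1 1 1) y,
          laplacian (laplacian w) y⟫)
      - (11 / 25 : ℝ) * (∫ y, ‖laplacian w y‖ ^ 2)
      ≤ -(0.85532 : ℝ) * (∫ y, ‖laplacian w y‖ ^ 2) := by
  have hsph' : ∀ k : Fin 3 → ℤ, freqNormSq k < (((51 : ℕ) : ℝ) + 1) ^ 2 →
      mFourierCoeff (EuclideanSpace.complexify ∘ w) k = 0 := fun k hk => hsph k (by norm_num at hk ⊢; exact hk)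
  have h := abc_sph_h2_tail_form_le hw hsph' (ν := 1 / 500) (ω := 11 / 25) (by norm_num)
  have hY : 0 ≤ ∫ y, ‖laplacian w y‖ ^ 2 := integral_nonneg fun y => sq_nonneg _
  have hη := eta2_at_52_bounds.1
  have e : ((51 : ℕ) : ℝ) + 1 = 52 := by norm_num
  rw [e] at h
  refine h.trans (mul_le_mul_of_nonneg_right ?_ hY)
  linarith

/-- **R 500: the `g_κ₀` TAIL SENTENCE as a number** (`κ₀ = 22` in the cell of record; any `κsq ≥ 0`):
weighted tail form `≤ −0.85532·(‖Δw‖²/16π⁴ + 2κ₀²‖∇w‖²/4π² + κ₀⁴‖w‖²)`, `ν = 1/500`, `ω = 11/25`. -/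
theorem abc_sph_weighted_tail_at_52 {w : UnitAddTorus (Fin 3) → EuclideanSpace ℝ (Fin 3)} (hw : IsSmooth w)
    (hsph : ∀ k : Fin 3 → ℤ, freqNormSq k < (52 : ℝ) ^ 2 →
      mFourierCoeff (EuclideanSpace.complexify ∘ w) k = 0)
    {κsq : ℝ} (hκ : 0 ≤ κsq) :
    1 / (16 * Real.pi ^ 4) *
        ((1 / 500 : ℝ) / (4 * Real.pi ^ 2) * (∫ y, ⟪laplacian (laplacian w) y, laplacian w y⟫)
          - 1 / (2 * Real.pi) * (∫ y, ⟪convect (Torus.abcFlow 1 1 1) w y + convect w (Torus.abcFlow 1 1 1) y,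
              laplacian (laplacian w) y⟫)
          - (11 / 25 : ℝ) * (∫ y, ‖laplacian w y‖ ^ 2))
      + 2 * κsq * (1 / (4 * Real.pi ^ 2) *
        (-((1 / 500 : ℝ) / (4 * Real.pi ^ 2) * ∫ y, ‖laplacian w y‖ ^ 2)
          + 1 / (2 * Real.pi) * (∫ y, ⟪convect (Torus.abcFlow 1 1 1) w y + convect w (Torus.abcFlow 1 1 1) y,
              laplacian w y⟫)
          - (11 / 25 : ℝ) * gradNormSq w))
      + κsq ^ 2 *
        ((1 / 500 : ℝ) / (4 * Real.pi ^ 2) * (∫ y, ⟪laplacian w y, w y⟫)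
          - 1 / (2 * Real.pi) * (∫ y, ⟪convect (Torus.abcFlow 1 1 1) w y + convect w (Torus.abcFlow 1 1 1) y, w y⟫)
          - (11 / 25 : ℝ) * (∫ y, ‖w y‖ ^ 2))
      ≤ -(0.85532 : ℝ) *
        (1 / (16 * Real.pi ^ 4) * (∫ y, ‖laplacian w y‖ ^ 2)
          + 2 * κsq * (1 / (4 * Real.pi ^ 2) * gradNormSq w)
          + κsq ^ 2 * (∫ y, ‖w y‖ ^ 2)) := by
  have hπ : 0 < Real.pi := Real.pi_pos
  have hsph' : ∀ k : Fin 3 → ℤ, freqNormSq k < (((51 : ℕ) : ℝ) + 1) ^ 2 →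
      mFourierCoeff (EuclideanSpace.complexify ∘ w) k = 0 := fun k hk => hsph k (by norm_num at hk ⊢; exact hk)
  have h := abc_sph_weighted_tail_form_le hw hsph' (ν := 1 / 500) (ω := 11 / 25) (by norm_num) hκ
  have e : ((51 : ℕ) : ℝ) + 1 = 52 := by norm_num
  rw [e, eta_t_at_52_eq_eta2] at h
  have hY : 0 ≤ ∫ y, ‖laplacian w y‖ ^ 2 := integral_nonneg fun y => sq_nonneg _
  have hG : 0 ≤ gradNormSq w := gradNormSq_nonneg _
  have hE : 0 ≤ ∫ y, ‖w y‖ ^ 2 := integral_nonneg fun y => sq_nonneg _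
  have hpos : 0 ≤ 1 / (16 * Real.pi ^ 4) * (∫ y, ‖laplacian w y‖ ^ 2)
      + 2 * κsq * (1 / (4 * Real.pi ^ 2) * gradNormSq w) + κsq ^ 2 * (∫ y, ‖w y‖ ^ 2) := by positivity
  have hη := eta2_at_52_bounds.1
  refine h.trans (mul_le_mul_of_nonneg_right ?_ hpos)
  linarith

end Summit.NavierStokesRegularity.FluidComputer.AbcFlowSphTailLadder
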